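import Literature.Dynamics.Homogeneous.OrthogonalGroupOrbitClosuresUnipotents
import Literature.Dynamics.Homogeneous.OrthogonalGroupOrbitClosures
import Literature.AlgebraicGeometry.Surfaces.K3CMPeriodLattice
import HarnessLib

/-!
# The plane of a K3 period vector: the hypotheses of the §2.1–§2.2 algebra, and the
# frame form of "`H = SO⁺(1,19)` is generated by unipotents"

Topic `Literature/Dynamics/Homogeneous`; theorems only (no new notion, no named fact — D-0026). This
file instantiates the field-general algebra of `OrthogonalGroupOrbitClosuresSubalgebras` (erratum
§2.1: Lie subalgebras between `𝔰𝔬(V₁^⊥)` and `𝔰𝔬(V)`) and `OrthogonalGroupOrbitClosuresUnipotents`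
(erratum §2.2: `𝔰𝔬(V₁^⊥)` is spanned by nilpotents; fixed vectors; centralizer) to the setting of
the named fact `Literature.Dynamics.Homogeneous.Verbitsky2017_orbitClosure_trichotomy_K3`:
`V = Λ_{K3} ⊗ ℝ = K3Index → ℝ` with the real K3 form `B = Matrix.toBilin' (k3Gram.map Int.cast)`
(signature `(3,19)`), and `V₁ = P_x = ⟨Re x, Im x⟩_ℝ` the plane of a period vector
`x ∈ D = k3PeriodDomain` (so `V₀ = P_x^⊥ ≅ ℝ^{1,19}` and `𝔰𝔬(V₀)` is the Lie algebra of the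
stabiliser `H` of the frame `(Re x, Im x)`, Verbitsky's `SO⁺(a−2,b) = SO⁺(1,19)`).

**Hypotheses verified** (for every `x ∈ D`): `B` symmetric (`isSymm_k3RForm`) and non-degenerate
(`k3RForm_nondegenerate`, `det Λ = −1`); `P_x` anisotropic, indeed positive definite
(`k3Plane_anisotropic`: `(a Re x + b Im x)² = (a² + b²)(Re x)²`, Huybrechts Ch. 6 Prop. 1.5) and
`2`-dimensional (`finrank_k3Plane`); `dim V = 22 ≥ 5` (`five_le_finrank_k3R`); and `P_x^⊥`
ISOTROPIC (`exists_isotropic_mem_orthogonal_k3Plane`): it meets the positive three-space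
`⟨e₁+f₁, e₂+f₂, e₃+f₃⟩ ⊂ U^{⊕3}` in a positive `p` and the negative three-space
`⟨e₁−f₁, e₂−f₂, e₃−f₃⟩` in a negative `n` (`3 + 20 > 22`,
`exists_ne_zero_mem_inf_orthogonal_k3Plane`), and `p + λn` is isotropic for a real root `λ` of the
indefinite quadratic `(n.n)λ² + 2(p.n)λ + (p.p)` (Mathlib's `exists_quadratic_eq_zero`).

**Consequences** (the §2.2 inputs of the Ratner route in the fact's own vocabulary):
`k3_so_frameStabilizer_mem_iff_mem_span_isotropicWedge` — a real endomorphism is skew and kills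
`Re x`, `Im x` iff it is a real combination of isotropic wedges `u ∧ w` (`u, w ⊥ P_x`,
`(u.u) = (u.w) = 0`; each cube-zero, exponentiating to a polynomial unipotent one-parameter group
of isometries fixing the frame); `k3_forall_isotropicWedge_apply_eq_zero_iff` — the common kernel
of these wedges (= fixed vectors of those unipotents) is `P_x`; `k3_forall_commute_isotropicWedge_iff`
— their commutant (= that of the unipotents) is "scalar on `P_x^⊥`, preserving `P_x`". The
remaining inputs of `…_of_frameOrbitClosure` (Ratner's theorem for `H ↷ SO(3,19)/SO(Λ)`,
Borel–Harish-Chandra, Borel density, the Lie correspondence) are not in Mathlib and not here.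

## References

* [Verbitsky2017ErgodicErratum] M. Verbitsky, Ergodic complex structures on hyperkähler manifolds:
  an erratum, arXiv:1708.05802 (2017), §2.2 (Theorem and proof: `H = SO⁺(a−2,b)` is generated by
  unipotents), §2.3.
* [Huybrechts2016K3] D. Huybrechts, Lectures on K3 Surfaces, CUP 2016, Ch. 6 Prop. 1.5 (period
  domain and positive planes), Ch. 14 §0.3 (vi) (`Λ_{K3}`: signature `(3,19)`, unimodular).
-/

noncomputable section

namespace Literature.Dynamics.Homogeneous

open Module
open scoped Matrix
open Literature.AlgebraicGeometry Literature.AlgebraicGeometry.Surfaces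

/-! ### The positive plane of a period vector in `Λ_{K3} ⊗ ℝ ≅ ℝ^{3,19}` -/

section K3Plane

/-- The real K3 form is symmetric (`IsSymm` form). [folklore] -/
theorem isSymm_k3RForm : (Matrix.toBilin' (k3Gram.map (Int.cast : ℤ → ℝ))).IsSymm :=
  ⟨fun u w => k3RForm_comm u w⟩

/-- `dim_ℝ (Λ_{K3} ⊗ ℝ) = 22 ≥ 5`. [folklore] -/
theorem five_le_finrank_k3R : 5 ≤ finrank ℝ (K3Index → ℝ) := by
  rw [Module.finrank_fintype_fun_eq_card]
  simp [Fintype.card_sum, Fintype.card_fin]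

/-- **The plane of a period vector is anisotropic** (positive definite): for `x ∈ D`,
`(a Re x + b Im x)² = (a² + b²)(Re x)²` with `(Re x)² > 0`. [cite: Huybrechts2016K3, Ch. 6 Prop. 1.5] -/
theorem k3Plane_anisotropic {x : K3Index → ℂ} (hx : x ∈ k3PeriodDomain) :
    ∀ v ∈ Submodule.span ℝ (Set.range ![fun i => (x i).re, fun i => (x i).im]),
      Matrix.toBilin' (k3Gram.map (Int.cast : ℤ → ℝ)) v v = 0 → v = 0 := by
  set B := Matrix.toBilin' (k3Gram.map (Int.cast : ℤ → ℝ)) with hB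
  obtain ⟨h12, h11, hpos⟩ := (mem_k3PeriodDomain_iff_k3RForm hB x).1 hx
  intro v hv hvv
  obtain ⟨c, rfl⟩ := (Submodule.mem_span_range_iff_exists_fun ℝ).1 hv
  have hsum : ∑ i, c i • ![fun i => (x i).re, fun i => (x i).im] i =
      c 0 • (fun i => (x i).re) + c 1 • (fun i => (x i).im) := by
    simp [Fin.sum_univ_two]
  rw [hsum] at hvv ⊢
  rw [twistorChain_comb2 B k3RForm_comm, h12, ← h11] at hvv
  have h0 : 0 ≤ c 0 * c 0 * B (fun i => (x i).re) (fun i => (x i).re) :=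
    mul_nonneg (mul_self_nonneg _) hpos.le
  have h1 : 0 ≤ c 1 * c 1 * B (fun i => (x i).re) (fun i => (x i).re) :=
    mul_nonneg (mul_self_nonneg _) hpos.le
  have e0 : c 0 * c 0 * B (fun i => (x i).re) (fun i => (x i).re) = 0 := by linarith
  have e1 : c 1 * c 1 * B (fun i => (x i).re) (fun i => (x i).re) = 0 := by linarith
  have c0 : c 0 = 0 := by
    rcases mul_eq_zero.1 e0 with h | h
    · exact mul_self_eq_zero.1 h
    · exact absurd h hpos.ne'
  have c1 : c 1 = 0 := by
    rcases mul_eq_zero.1 e1 with h | h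
    · exact mul_self_eq_zero.1 h
    · exact absurd h hpos.ne'
  rw [c0, c1, zero_smul, zero_smul, add_zero]

/-- `Re x, Im x` are linearly independent for `x ∈ D`. [cite: Huybrechts2016K3, Ch. 6 Prop. 1.5] -/
theorem k3Plane_linearIndependent {x : K3Index → ℂ} (hx : x ∈ k3PeriodDomain) :
    LinearIndependent ℝ ![fun i => (x i).re, fun i => (x i).im] := by
  rw [Fintype.linearIndependent_iff]
  intro c hc i
  set B := Matrix.toBilin' (k3Gram.map (Int.cast : ℤ → ℝ)) with hB
  obtain ⟨h12, h11, hpos⟩ := (mem_k3PeriodDomain_iff_k3RForm hB x).1 hx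
  have hsum : ∑ i, c i • ![fun i => (x i).re, fun i => (x i).im] i =
      c 0 • (fun i => (x i).re) + c 1 • (fun i => (x i).im) := by
    simp [Fin.sum_univ_two]
  have hq : B (c 0 • (fun i => (x i).re) + c 1 • (fun i => (x i).im))
      (c 0 • (fun i => (x i).re) + c 1 • (fun i => (x i).im)) = 0 := by
    rw [← hsum, hc]; simp
  rw [twistorChain_comb2 B k3RForm_comm, h12, ← h11] at hq
  have e0 : 0 ≤ c 0 * c 0 * B (fun i => (x i).re) (fun i => (x i).re) :=
    mul_nonneg (mul_self_nonneg _) hpos.le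
  have e1 : 0 ≤ c 1 * c 1 * B (fun i => (x i).re) (fun i => (x i).re) :=
    mul_nonneg (mul_self_nonneg _) hpos.le
  have f0 : c 0 * c 0 * B (fun i => (x i).re) (fun i => (x i).re) = 0 := by linarith
  have f1 : c 1 * c 1 * B (fun i => (x i).re) (fun i => (x i).re) = 0 := by linarith
  have c0 : c 0 = 0 := by
    rcases mul_eq_zero.1 f0 with h | h
    · exact mul_self_eq_zero.1 h
    · exact absurd h hpos.ne'
  have c1 : c 1 = 0 := by
    rcases mul_eq_zero.1 f1 with h | h
    · exact mul_self_eq_zero.1 h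
    · exact absurd h hpos.ne'
  fin_cases i
  · exact c0
  · exact c1

/-- The plane of a period vector is `2`-dimensional. [cite: Huybrechts2016K3, Ch. 6 Prop. 1.5] -/
theorem finrank_k3Plane {x : K3Index → ℂ} (hx : x ∈ k3PeriodDomain) :
    finrank ℝ (Submodule.span ℝ (Set.range ![fun i => (x i).re, fun i => (x i).im])) = 2 := by
  rw [finrank_span_eq_card (k3Plane_linearIndependent hx)]
  simp

/-- A three-space meets the orthogonal complement of a plane non-trivially in `Λ_{K3} ⊗ ℝ`
(`3 + 20 > 22`). [folklore] -/
theorem exists_ne_zero_mem_inf_orthogonal_k3Plane {x : K3Index → ℂ} (hx : x ∈ k3PeriodDomain)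
    {t : Fin 3 → K3Index → ℝ} (ht : LinearIndependent ℝ t) :
    ∃ p ∈ Submodule.span ℝ (Set.range t), p ≠ 0 ∧
      p ∈ (Matrix.toBilin' (k3Gram.map (Int.cast : ℤ → ℝ))).orthogonal
        (Submodule.span ℝ (Set.range ![fun i => (x i).re, fun i => (x i).im])) := by
  set B := Matrix.toBilin' (k3Gram.map (Int.cast : ℤ → ℝ)) with hB
  set W := Submodule.span ℝ (Set.range t) with hW
  set V₀ := B.orthogonal (Submodule.span ℝ (Set.range ![fun i => (x i).re, fun i => (x i).im]))
    with hV₀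
  have hW3 : finrank ℝ W = 3 := by rw [hW, finrank_span_eq_card ht]; simp
  have hV₀20 : finrank ℝ V₀ = 20 := by
    rw [hV₀, LinearMap.BilinForm.finrank_orthogonal k3RForm_nondegenerate, finrank_k3Plane hx,
      Module.finrank_fintype_fun_eq_card]
    simp [Fintype.card_sum, Fintype.card_fin]
  have h22 : finrank ℝ ↥(W ⊔ V₀) ≤ 22 := by
    have := Submodule.finrank_le (W ⊔ V₀)
    rw [Module.finrank_fintype_fun_eq_card] at this
    simpa [Fintype.card_sum, Fintype.card_fin] using this
  have hdim := Submodule.finrank_sup_add_finrank_inf_eq W V₀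
  have hinf : 1 ≤ finrank ℝ ↥(W ⊓ V₀) := by omega
  have hne : W ⊓ V₀ ≠ ⊥ := fun h => by
    rw [h, finrank_bot] at hinf; omega
  obtain ⟨p, hp, hp0⟩ := (Submodule.ne_bot_iff _).1 hne
  exact ⟨p, hp.1, hp0, hp.2⟩

/-- **The orthogonal complement of the plane of a period vector is isotropic**: it contains a
non-zero vector `u` with `(u.u) = 0` (it has signature `(1,19)`; here: it meets the positive
three-space `⟨e₁+f₁, e₂+f₂, e₃+f₃⟩` in a positive `p` and the negative three-space
`⟨e₁−f₁, e₂−f₂, e₃−f₃⟩` in a negative `n`, and `p + λ n` is isotropic for a root `λ` of the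
indefinite quadratic `(p.p) + 2λ(p.n) + λ²(n.n)`). [cite: Huybrechts2016K3, Ch. 14 §0.3 (vi) (signature (3,19) of Λ_{K3})] -/
theorem exists_isotropic_mem_orthogonal_k3Plane {x : K3Index → ℂ} (hx : x ∈ k3PeriodDomain) :
    ∃ u ∈ (Matrix.toBilin' (k3Gram.map (Int.cast : ℤ → ℝ))).orthogonal
        (Submodule.span ℝ (Set.range ![fun i => (x i).re, fun i => (x i).im])),
      u ≠ 0 ∧ Matrix.toBilin' (k3Gram.map (Int.cast : ℤ → ℝ)) u u = 0 := by
  set B := Matrix.toBilin' (k3Gram.map (Int.cast : ℤ → ℝ)) with hB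
  -- the positive and negative orthogonal triples in `U ⊕ U ⊕ U`
  let h₁ : K3Index → ℝ := Sum.elim 0 (Sum.elim (fun _ => 1) 0)
  let h₂ : K3Index → ℝ := Sum.elim 0 (Sum.elim 0 (Sum.elim (fun _ => 1) 0))
  let h₃ : K3Index → ℝ := Sum.elim 0 (Sum.elim 0 (Sum.elim 0 fun _ => 1))
  let n₁ : K3Index → ℝ := Sum.elim 0 (Sum.elim ![1, -1] 0)
  let n₂ : K3Index → ℝ := Sum.elim 0 (Sum.elim 0 (Sum.elim ![1, -1] 0))
  let n₃ : K3Index → ℝ := Sum.elim 0 (Sum.elim 0 (Sum.elim 0 ![1, -1]))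
  have e11 : B h₁ h₁ = 2 := by
    rw [hB, k3RForm_apply]
    simp [h₁, Fintype.sum_sum_type, Fin.sum_univ_two, k3Gram, hyperbolicPlaneGram]
    norm_num
  have e22 : B h₂ h₂ = 2 := by
    rw [hB, k3RForm_apply]
    simp [h₂, Fintype.sum_sum_type, Fin.sum_univ_two, k3Gram, hyperbolicPlaneGram]
    norm_num
  have e33 : B h₃ h₃ = 2 := by
    rw [hB, k3RForm_apply]
    simp [h₃, Fintype.sum_sum_type, Fin.sum_univ_two, k3Gram, hyperbolicPlaneGram]
    norm_num
  have e12 : B h₁ h₂ = 0 := by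
    rw [hB, k3RForm_apply]
    simp [h₁, h₂, Fintype.sum_sum_type, Fin.sum_univ_two, k3Gram, hyperbolicPlaneGram]
  have e13 : B h₁ h₃ = 0 := by
    rw [hB, k3RForm_apply]
    simp [h₁, h₃, Fintype.sum_sum_type, Fin.sum_univ_two, k3Gram, hyperbolicPlaneGram]
  have e23 : B h₂ h₃ = 0 := by
    rw [hB, k3RForm_apply]
    simp [h₂, h₃, Fintype.sum_sum_type, Fin.sum_univ_two, k3Gram, hyperbolicPlaneGram]
  have m11 : B n₁ n₁ = -2 := by
    rw [hB, k3RForm_apply]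
    simp [n₁, Fintype.sum_sum_type, Fin.sum_univ_two, k3Gram, hyperbolicPlaneGram]
    norm_num
  have m22 : B n₂ n₂ = -2 := by
    rw [hB, k3RForm_apply]
    simp [n₂, Fintype.sum_sum_type, Fin.sum_univ_two, k3Gram, hyperbolicPlaneGram]
    norm_num
  have m33 : B n₃ n₃ = -2 := by
    rw [hB, k3RForm_apply]
    simp [n₃, Fintype.sum_sum_type, Fin.sum_univ_two, k3Gram, hyperbolicPlaneGram]
    norm_num
  have m12 : B n₁ n₂ = 0 := by
    rw [hB, k3RForm_apply]
    simp [n₁, n₂, Fintype.sum_sum_type, Fin.sum_univ_two, k3Gram, hyperbolicPlaneGram]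
  have m13 : B n₁ n₃ = 0 := by
    rw [hB, k3RForm_apply]
    simp [n₁, n₃, Fintype.sum_sum_type, Fin.sum_univ_two, k3Gram, hyperbolicPlaneGram]
  have m23 : B n₂ n₃ = 0 := by
    rw [hB, k3RForm_apply]
    simp [n₂, n₃, Fintype.sum_sum_type, Fin.sum_univ_two, k3Gram, hyperbolicPlaneGram]
  have hposF := twistorChain_posFamily_of_orthogonal B k3RForm_comm e12 e13 e23
    (by rw [e11]; norm_num) (by rw [e22]; norm_num) (by rw [e33]; norm_num)
  have hnegF : ∀ c : Fin 3 → ℝ, c ≠ 0 → B (∑ i, c i • ![n₁, n₂, n₃] i) (∑ i, c i • ![n₁, n₂, n₃] i) < 0 := by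
    have hBs' : ∀ u w, (-B) u w = (-B) w u := fun u w => by
      simp only [LinearMap.neg_apply]; rw [k3RForm_comm]
    have := twistorChain_posFamily_of_orthogonal (-B) hBs' (u := n₁) (v := n₂) (w := n₃)
      (by simp [m12]) (by simp [m13]) (by simp [m23])
      (by simp [m11]) (by simp [m22]) (by simp [m33])
    intro c hc
    have h := this c hc
    simp only [LinearMap.neg_apply] at h
    linarith
  -- a positive `p` and a negative `n` in `V₀`
  obtain ⟨p, hpW, hp0, hpV₀⟩ := exists_ne_zero_mem_inf_orthogonal_k3Plane hx
    (twistorChain_linearIndependent B hposF)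
  obtain ⟨n, hnW, hn0, hnV₀⟩ := exists_ne_zero_mem_inf_orthogonal_k3Plane hx
    (twistorChain_linearIndependent (-B) fun c hc => by
      have h := hnegF c hc
      simp only [LinearMap.neg_apply]
      linarith)
  obtain ⟨cp, rfl⟩ := (Submodule.mem_span_range_iff_exists_fun ℝ).1 hpW
  obtain ⟨cn, rfl⟩ := (Submodule.mem_span_range_iff_exists_fun ℝ).1 hnW
  have hcp : cp ≠ 0 := fun h => hp0 (by simp [h])
  have hcn : cn ≠ 0 := fun h => hn0 (by simp [h])
  have hp := hposF cp hcp
  have hn := hnegF cn hcn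
  set p := ∑ i, cp i • ![h₁, h₂, h₃] i with hpdef
  set n := ∑ i, cn i • ![n₁, n₂, n₃] i with hndef
  -- the isotropic combination `p + λ n`
  have ha : B n n ≠ 0 := hn.ne
  have hdisc : ∃ s, discrim (B n n) (2 * B p n) (B p p) = s * s := by
    refine ⟨Real.sqrt (discrim (B n n) (2 * B p n) (B p p)), (Real.mul_self_sqrt ?_).symm⟩
    rw [discrim]
    nlinarith [sq_nonneg (B p n)]
  obtain ⟨l, hl⟩ := exists_quadratic_eq_zero ha hdisc
  refine ⟨p + l • n, Submodule.add_mem _ hpV₀ (Submodule.smul_mem _ _ hnV₀), ?_, ?_⟩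
  · intro h0
    have hpn : p = (-l) • n := by rw [neg_smul]; exact eq_neg_of_add_eq_zero_left h0
    have : B p p = l * l * B n n := by
      rw [hpn]
      simp only [LinearMap.BilinForm.smul_left, LinearMap.BilinForm.smul_right]
      ring
    have : B p p ≤ 0 := by rw [this]; nlinarith [mul_self_nonneg l]
    linarith
  · have hnp : B n p = B p n := k3RForm_comm n p
    have : B (p + l • n) (p + l • n) = B n n * (l * l) + 2 * B p n * l + B p p := by
      simp only [LinearMap.BilinForm.add_left, LinearMap.BilinForm.add_right,
        LinearMap.BilinForm.smul_left, LinearMap.BilinForm.smul_right, hnp]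
      ring
    rw [this, hl]

end K3Plane

/-! ### The §2.2 algebra for the plane of a K3 period vector -/

section K3Corollaries

open SkewPlane

/-- **`𝔰𝔬(P_x^⊥) ⊂ 𝔰𝔬(3,19)` is spanned by nilpotent elements, frame form** (Verbitsky's "`H` is
generated by unipotents" for `H = SO⁺(1,19)` the connected stabiliser of the frame `(Re x, Im x)` of
a period vector `x ∈ D` of the K3 lattice, at the Lie-algebra level): a real endomorphism of
`Λ_{K3} ⊗ ℝ` is skew for the K3 form and kills `Re x` and `Im x` iff it is a real linear
combination of isotropic wedges `u ∧ w` (`u, w ⊥ Re x, Im x`, `(u.u) = (u.w) = 0`), each of which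
has cube zero (`SkewPlane.bwedge_pow_three_of_isotropic`) and exponentiates to the polynomial
unipotent one-parameter group `1 + t u∧w + ½t²(u∧w)²` of isometries fixing `Re x`, `Im x`
(`SkewPlane.unipotent_mul_unipotent`, `SkewPlane.B_unipotent_apply`). [cite: Verbitsky2017ErgodicErratum, §2.2 (proof of the Theorem: "the group H is generated by unipotents")] -/
theorem k3_so_frameStabilizer_mem_iff_mem_span_isotropicWedge {x : K3Index → ℂ}
    (hx : x ∈ k3PeriodDomain) (f : Module.End ℝ (K3Index → ℝ)) :
    (f ∈ skewAdjointLieSubalgebra (Matrix.toBilin' (k3Gram.map (Int.cast : ℤ → ℝ))) ∧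
        f (fun i => (x i).re) = 0 ∧ f (fun i => (x i).im) = 0) ↔
      f ∈ Submodule.span ℝ {g : Module.End ℝ (K3Index → ℝ) |
        ∃ u ∈ (Matrix.toBilin' (k3Gram.map (Int.cast : ℤ → ℝ))).orthogonal
            (Submodule.span ℝ (Set.range ![fun i => (x i).re, fun i => (x i).im])),
          ∃ w ∈ (Matrix.toBilin' (k3Gram.map (Int.cast : ℤ → ℝ))).orthogonal
            (Submodule.span ℝ (Set.range ![fun i => (x i).re, fun i => (x i).im])),
          Matrix.toBilin' (k3Gram.map (Int.cast : ℤ → ℝ)) u u = 0 ∧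
            Matrix.toBilin' (k3Gram.map (Int.cast : ℤ → ℝ)) u w = 0 ∧
            g = LinearMap.smulRight (Matrix.toBilin' (k3Gram.map (Int.cast : ℤ → ℝ)) w) u -
              LinearMap.smulRight (Matrix.toBilin' (k3Gram.map (Int.cast : ℤ → ℝ)) u) w} := by
  rw [← so_orthogonal_mem_iff_mem_span_isotropicWedge isSymm_k3RForm k3RForm_nondegenerate
    (k3Plane_anisotropic hx) (finrank_k3Plane hx) five_le_finrank_k3R
    (exists_isotropic_mem_orthogonal_k3Plane hx) f]
  refine and_congr_right fun _ => ⟨fun ⟨h1, h2⟩ v hv => ?_, fun h => ⟨h _ ?_, h _ ?_⟩⟩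
  · obtain ⟨c, rfl⟩ := (Submodule.mem_span_range_iff_exists_fun ℝ).1 hv
    simp [Fin.sum_univ_two, h1, h2]
  · exact Submodule.subset_span ⟨0, rfl⟩
  · exact Submodule.subset_span ⟨1, rfl⟩

/-- **Fixed vectors, K3 frame form**: a real vector of `Λ_{K3} ⊗ ℝ` is killed by every isotropic
wedge `u ∧ w` with `u, w ⊥ Re x, Im x` (equivalently: fixed by all the unipotents
`1 + t u∧w + ½t²(u∧w)²`, `SkewPlane.unipotent_apply_eq_self_iff`) iff it lies in the plane
`⟨Re x, Im x⟩`. (With Borel density: the Ratner group `SO(P_x^⊥)°` forces `P_x` rational.)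
[folklore] -/
theorem k3_forall_isotropicWedge_apply_eq_zero_iff {x : K3Index → ℂ} (hx : x ∈ k3PeriodDomain)
    (y : K3Index → ℝ) :
    (∀ u ∈ (Matrix.toBilin' (k3Gram.map (Int.cast : ℤ → ℝ))).orthogonal
        (Submodule.span ℝ (Set.range ![fun i => (x i).re, fun i => (x i).im])),
      ∀ w ∈ (Matrix.toBilin' (k3Gram.map (Int.cast : ℤ → ℝ))).orthogonal
        (Submodule.span ℝ (Set.range ![fun i => (x i).re, fun i => (x i).im])),
      Matrix.toBilin' (k3Gram.map (Int.cast : ℤ → ℝ)) u u = 0 →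
      Matrix.toBilin' (k3Gram.map (Int.cast : ℤ → ℝ)) u w = 0 →
      (LinearMap.smulRight (Matrix.toBilin' (k3Gram.map (Int.cast : ℤ → ℝ)) w) u -
        LinearMap.smulRight (Matrix.toBilin' (k3Gram.map (Int.cast : ℤ → ℝ)) u) w) y = 0) ↔
    ∃ a b : ℝ, y = a • (fun i => (x i).re) + b • (fun i => (x i).im) := by
  rw [forall_isotropicWedge_apply_eq_zero_iff isSymm_k3RForm k3RForm_nondegenerate
    (k3Plane_anisotropic hx) (finrank_k3Plane hx) five_le_finrank_k3R
    (exists_isotropic_mem_orthogonal_k3Plane hx) y, Submodule.mem_span_range_iff_exists_fun]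
  constructor
  · rintro ⟨c, rfl⟩
    exact ⟨c 0, c 1, by simp [Fin.sum_univ_two]⟩
  · rintro ⟨a, b, rfl⟩
    exact ⟨![a, b], by simp [Fin.sum_univ_two]⟩

/-- **Centralizer, K3 frame form** (Schur for `𝔰𝔬(1,19) ↷ ℝ^{1,19}`): a real endomorphism `T` of
`Λ_{K3} ⊗ ℝ` commutes with every isotropic wedge `u ∧ w`, `u, w ⊥ Re x, Im x` (equivalently with
all the unipotents `1 + t u∧w + ½t²(u∧w)²`, `SkewPlane.commute_unipotent_iff`) iff `T` is a scalar
on `P_x^⊥` and maps `P_x = ⟨Re x, Im x⟩` into itself. (With Borel density: the Ratner group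
`SO(P_x^⊥)°·SO(P_x)` forces `P_x` rational.) [folklore] -/
theorem k3_forall_commute_isotropicWedge_iff {x : K3Index → ℂ} (hx : x ∈ k3PeriodDomain)
    (T : Module.End ℝ (K3Index → ℝ)) :
    (∀ u ∈ (Matrix.toBilin' (k3Gram.map (Int.cast : ℤ → ℝ))).orthogonal
        (Submodule.span ℝ (Set.range ![fun i => (x i).re, fun i => (x i).im])),
      ∀ w ∈ (Matrix.toBilin' (k3Gram.map (Int.cast : ℤ → ℝ))).orthogonal
        (Submodule.span ℝ (Set.range ![fun i => (x i).re, fun i => (x i).im])),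
      Matrix.toBilin' (k3Gram.map (Int.cast : ℤ → ℝ)) u u = 0 →
      Matrix.toBilin' (k3Gram.map (Int.cast : ℤ → ℝ)) u w = 0 →
      T * (LinearMap.smulRight (Matrix.toBilin' (k3Gram.map (Int.cast : ℤ → ℝ)) w) u -
          LinearMap.smulRight (Matrix.toBilin' (k3Gram.map (Int.cast : ℤ → ℝ)) u) w) =
        (LinearMap.smulRight (Matrix.toBilin' (k3Gram.map (Int.cast : ℤ → ℝ)) w) u -
          LinearMap.smulRight (Matrix.toBilin' (k3Gram.map (Int.cast : ℤ → ℝ)) u) w) * T) ↔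
    (∃ α : ℝ, ∀ v ∈ (Matrix.toBilin' (k3Gram.map (Int.cast : ℤ → ℝ))).orthogonal
        (Submodule.span ℝ (Set.range ![fun i => (x i).re, fun i => (x i).im])), T v = α • v) ∧
      (∀ e ∈ Submodule.span ℝ (Set.range ![fun i => (x i).re, fun i => (x i).im]),
        T e ∈ Submodule.span ℝ (Set.range ![fun i => (x i).re, fun i => (x i).im])) :=
  forall_commute_isotropicWedge_iff isSymm_k3RForm k3RForm_nondegenerate
    (k3Plane_anisotropic hx) (finrank_k3Plane hx) five_le_finrank_k3R
    (exists_isotropic_mem_orthogonal_k3Plane hx) T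

end K3Corollaries

end Literature.Dynamics.Homogeneous
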